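import Summits.QuantumFields.YangMills.Theorems.LuscherReductionDressedRitzPolyakovLiftShadowChartRadial
import Summits.QuantumFields.YangMills.Theorems.LuscherReductionTwistedTraceScalingTangentChart
import HarnessLib

/-!
# Crux `DressedRitz` (stmt-QuantumFields-20205), line «polyakovlift» r6, wave 2 / F8c part 1b — the ROOT CHART IS LIPSCHITZ on the polar caps,
# uniformly in `L` (one-link gnomonic geometry and Hilbert–Schmidt distances)

Support module (fleet seat ym-20205-polyakovlift-s1 gen 2, for the LEAD's wave-2 brief W2-F8 (c); `--supports stmt-QuantumFields-20205`, helper, no closure claim).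
Continues `…PolyakovLiftShadowChartRadial.lean` (root rescaling 6-Lipschitz on the chart ball):

* §4 one link: `sum_gnLink_sub_sq_le` — on a same-sign polar cap `u₀ ≥ c` the gnomonic coordinate is Lipschitz, `Σ_a(gn W − gn W')_a² ≤ ‖W − W'‖_F²/c⁴`;
  `gnNorm_le_one_of_scalarPart` (`|u₀| ≥ 3/4 ⇒ |gn W| ≤ 1`); (`‖U − V‖_F = ‖UV⁻¹ − 1‖_F` is the tree's `frobNorm_sub_eq_mul_inv`) and ★
  `frobNorm_pow_sub_pow_le` (`‖U^L − V^L‖_F ≤ L·‖U − V‖_F`, telescoping + unitary invariance) — the factor `L` of F8c;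
* §5 ★ `norm_rootCoord_sub_sq_le` — for one-site configurations whose links lie in the polar cap `u₀ ≥ 3/4`:
  `‖rootCoord L μ U − rootCoord L μ V‖² ≤ (114/μ²)·Σ_i ‖U_i − V_i‖_F²`, uniformly in `L ≥ 1`.

HONEST FRAMING: chart calculus at fixed lattice on the conditional femto rung R2b1; serves ONE stub's (S-PSCAL″) soft error; nothing here bears on infinite volume,
the continuum limit or the Clay gap.
References: Bröcker–tom Dieck I (1.10) [cite: BrockerTomDieck1985, I (1.10)]; I. Montvay, G. Münster (1994) §3.2.3 (3.97) [cite: MontvayMunster1994, §3.2.3 (3.97)];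
M. Lüscher, NPB 219 (1983) 233 [cite: Luscher1983, §2].
-/

set_option autoImplicit false

noncomputable section

open MeasureTheory Filter Topology Real
open scoped Matrix ComplexConjugate BigOperators
open Literature.MathematicalPhysics.QuantumFieldTheory
open Literature.MathematicalPhysics.QuantumLattice
open Literature.Analysis.OperatorTheory.YMMatrixModel (ZM)

namespace Summit.QuantumFields.YangMills.Theorems.FemtoTransferGap.PolyakovLift

open Summit.QuantumFields.YangMills.Theorems.FemtoTransferGap
open Summit.QuantumFields.YangMills.Theorems.FemtoTransferGap.TwoLattice.Chart (frobNorm_sub_sq_eq)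

/-! ## §4 One link: the gnomonic coordinate on a polar cap; Frobenius distances -/

/-- `0 ≤ rootProfile L t` for `t ≥ 0`, `L ≥ 1` (all radii, not only the chart ball). [folklore] -/
theorem rootProfile_nonneg {L : ℕ} (hL : 1 ≤ L) {t : ℝ} (ht : 0 ≤ t) : 0 ≤ rootProfile L t := by
  rcases ht.eq_or_lt with h | hpos
  · rw [← h]; simp [rootProfile]
  · have hge : 0 ≤ rootProfile L t * t := by rw [rootProfile_mul_self]; exact rootPsi_nonneg hL ht
    by_contra hneg
    push Not at hneg
    nlinarith [mul_neg_of_neg_of_pos hneg hpos]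

/-- `u₀²·(1 + |gn W|²) = 1` off the equator (`|gn|² = |u|²/u₀² = (1 − u₀²)/u₀²`). [cite: BrockerTomDieck1985, I (1.10)] -/
theorem scalarPart_sq_mul_one_add_gnNorm_sq {W : SU2} (hs : scalarPart W ≠ 0) : scalarPart W ^ 2 * (1 + gnNorm W ^ 2) = 1 := by
  have hsum : gnNorm W ^ 2 = (1 - scalarPart W ^ 2) / scalarPart W ^ 2 := by
    rw [gnNorm, Real.sq_sqrt (Finset.sum_nonneg fun _ _ => sq_nonneg _)]
    simp_rw [gnLink_apply, div_pow, ← Finset.sum_div, sum_vecPart_sq]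
  rw [hsum]
  field_simp
  ring


/-- **The gnomonic coordinate is Lipschitz on a same-sign polar cap**: for `W, W'` with `c ≤ scalarPart W`, `c ≤ scalarPart W'` (`0 < c ≤ 1`),
`Σ_a (gn W − gn W')_a² ≤ ‖W − W'‖_F² / c⁴`. [cite: BrockerTomDieck1985, I (1.10)] -/
theorem sum_gnLink_sub_sq_le {c : ℝ} (hc : 0 < c) (hc1 : c ≤ 1) {W W' : SU2} (hW : c ≤ scalarPart W) (hW' : c ≤ scalarPart W') :
    ∑ a, (gnLink W a - gnLink W' a) ^ 2 ≤ frobNorm ((W : Matrix (Fin 2) (Fin 2) ℂ) - (W' : Matrix (Fin 2) (Fin 2) ℂ)) ^ 2 / c ^ 4 := by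
  set s := scalarPart W with hs
  set s' := scalarPart W' with hs'
  have hs0 : 0 < s := hc.trans_le hW
  have hs'0 : 0 < s' := hc.trans_le hW'
  have hc2 : c ^ 2 ≤ s ^ 2 := pow_le_pow_left₀ hc.le hW 2
  have hc2' : c ^ 2 ≤ s' ^ 2 := pow_le_pow_left₀ hc.le hW' 2
  have hc4 : c ^ 4 ≤ s ^ 2 * s' ^ 2 := by
    calc c ^ 4 = c ^ 2 * c ^ 2 := by ring
      _ ≤ s ^ 2 * s' ^ 2 := mul_le_mul hc2 hc2' (sq_nonneg c) (sq_nonneg s)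
  have hc42 : c ^ 4 ≤ c ^ 2 := by nlinarith [sq_nonneg c, mul_le_mul hc1 hc1 hc.le zero_le_one]
  -- per component
  have hcomp : ∀ a, (gnLink W a - gnLink W' a) ^ 2 ≤
      2 * (vecPart W a - vecPart W' a) ^ 2 / c ^ 2 + 2 * (vecPart W' a ^ 2 * (s - s') ^ 2) / c ^ 4 := by
    intro a
    set p := vecPart W a
    set p' := vecPart W' a
    rw [gnLink_apply, gnLink_apply, ← hs, ← hs', div_sub_div _ _ hs0.ne' hs'0.ne', div_pow]
    have key : (p * s' - s * p') ^ 2 ≤ 2 * ((p - p') ^ 2 * s' ^ 2) + 2 * (p' ^ 2 * (s - s') ^ 2) := by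
      nlinarith [sq_nonneg ((p - p') * s' - p' * (s' - s))]
    have h1 : (p - p') ^ 2 * s' ^ 2 / (s * s') ^ 2 ≤ (p - p') ^ 2 / c ^ 2 := by
      rw [show (p - p') ^ 2 * s' ^ 2 / (s * s') ^ 2 = (p - p') ^ 2 / s ^ 2 by field_simp]
      exact div_le_div_of_nonneg_left (sq_nonneg _) (pow_pos hc 2) hc2
    have h2 : p' ^ 2 * (s - s') ^ 2 / (s * s') ^ 2 ≤ p' ^ 2 * (s - s') ^ 2 / c ^ 4 := by
      rw [show (s * s') ^ 2 = s ^ 2 * s' ^ 2 by ring]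
      exact div_le_div_of_nonneg_left (by positivity) (pow_pos hc 4) hc4
    have hpos : 0 < (s * s') ^ 2 := by positivity
    calc (p * s' - s * p') ^ 2 / (s * s') ^ 2 ≤ (2 * ((p - p') ^ 2 * s' ^ 2) + 2 * (p' ^ 2 * (s - s') ^ 2)) / (s * s') ^ 2 :=
          div_le_div_of_nonneg_right key hpos.le
      _ = 2 * ((p - p') ^ 2 * s' ^ 2 / (s * s') ^ 2) + 2 * (p' ^ 2 * (s - s') ^ 2 / (s * s') ^ 2) := by ring
      _ ≤ 2 * ((p - p') ^ 2 / c ^ 2) + 2 * (p' ^ 2 * (s - s') ^ 2 / c ^ 4) := by linarith [h1, h2]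
      _ = 2 * (p - p') ^ 2 / c ^ 2 + 2 * (p' ^ 2 * (s - s') ^ 2) / c ^ 4 := by ring
  have hv' : ∑ a, vecPart W' a ^ 2 ≤ 1 := sum_vecPart_sq_le W'
  have hfrob := frobNorm_sub_sq_eq W W'
  have hsum1 : ∑ a, (2 * (vecPart W a - vecPart W' a) ^ 2 / c ^ 2 + 2 * (vecPart W' a ^ 2 * (s - s') ^ 2) / c ^ 4) =
      2 / c ^ 2 * ∑ a, (vecPart W a - vecPart W' a) ^ 2 + 2 * (s - s') ^ 2 / c ^ 4 * ∑ a, vecPart W' a ^ 2 := by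
    rw [Finset.sum_add_distrib, Finset.mul_sum, Finset.mul_sum]
    congr 1 <;> refine Finset.sum_congr rfl fun a _ => ?_ <;> ring
  have hD0 : 0 ≤ ∑ a, (vecPart W a - vecPart W' a) ^ 2 := Finset.sum_nonneg fun _ _ => sq_nonneg _
  calc ∑ a, (gnLink W a - gnLink W' a) ^ 2
      ≤ ∑ a, (2 * (vecPart W a - vecPart W' a) ^ 2 / c ^ 2 + 2 * (vecPart W' a ^ 2 * (s - s') ^ 2) / c ^ 4) := Finset.sum_le_sum fun a _ => hcomp a
    _ = 2 / c ^ 2 * ∑ a, (vecPart W a - vecPart W' a) ^ 2 + 2 * (s - s') ^ 2 / c ^ 4 * ∑ a, vecPart W' a ^ 2 := hsum1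
    _ ≤ 2 / c ^ 4 * ∑ a, (vecPart W a - vecPart W' a) ^ 2 + 2 * (s - s') ^ 2 / c ^ 4 * 1 := by
        refine add_le_add ?_ (mul_le_mul_of_nonneg_left hv' (by positivity))
        exact mul_le_mul_of_nonneg_right (div_le_div_of_nonneg_left (by norm_num) (pow_pos hc 4) hc42) hD0
    _ = frobNorm ((W : Matrix (Fin 2) (Fin 2) ℂ) - (W' : Matrix (Fin 2) (Fin 2) ℂ)) ^ 2 / c ^ 4 := by
        rw [hfrob]; ring

/-- On the polar cap `|u₀| ≥ 3/4` the gnomonic radius is at most `1`: `Σ_a gn(W)_a² ≤ 1`. [folklore] -/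
theorem sum_gnLink_sq_le_one_of_scalarPart {W : SU2} (h : 3 / 4 ≤ |scalarPart W|) : ∑ a, gnLink W a ^ 2 ≤ 1 := by
  have hs : 0 < |scalarPart W| := lt_of_lt_of_le (by norm_num) h
  have hsum : ∑ a, gnLink W a ^ 2 = (1 - scalarPart W ^ 2) / scalarPart W ^ 2 := by
    simp_rw [gnLink_apply, div_pow, ← Finset.sum_div, sum_vecPart_sq]
  have hs2 : 0 < scalarPart W ^ 2 := by rw [← sq_abs]; exact pow_pos hs 2
  rw [hsum, div_le_one hs2]
  have h2 : (3 / 4 : ℝ) ^ 2 ≤ scalarPart W ^ 2 := by rw [← sq_abs (scalarPart W)]; exact pow_le_pow_left₀ (by norm_num) h 2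
  nlinarith

/-- `gnNorm W ≤ 1` on the polar cap `|u₀| ≥ 3/4`. [folklore] -/
theorem gnNorm_le_one_of_scalarPart {W : SU2} (h : 3 / 4 ≤ |scalarPart W|) : gnNorm W ≤ 1 := by
  unfold gnNorm
  rw [show (1 : ℝ) = Real.sqrt 1 by rw [Real.sqrt_one]]
  exact Real.sqrt_le_sqrt (sum_gnLink_sq_le_one_of_scalarPart h)

/-- Coercion of a product in `SU(2)` to matrices. [folklore] -/
theorem su2_coe_mul (U V : SU2) : ((U * V : SU2) : Matrix (Fin 2) (Fin 2) ℂ) = (U : Matrix (Fin 2) (Fin 2) ℂ) * (V : Matrix (Fin 2) (Fin 2) ℂ) := rfl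

/-- Coercion of `1 ∈ SU(2)`. [folklore] -/
theorem su2_coe_one : ((1 : SU2) : Matrix (Fin 2) (Fin 2) ℂ) = 1 := rfl

/-- ★ **The power map is `L`-Lipschitz in the Hilbert–Schmidt norm**: `‖U^L − V^L‖_F ≤ L·‖U − V‖_F` on `SU(2)`
(`U^{n+1} − V^{n+1} = U(U^n − V^n) + (U − V)V^n`, unitary invariance). [folklore] -/
theorem frobNorm_pow_sub_pow_le (U V : SU2) (L : ℕ) :
    frobNorm (((U ^ L : SU2) : Matrix (Fin 2) (Fin 2) ℂ) - ((V ^ L : SU2) : Matrix (Fin 2) (Fin 2) ℂ)) ≤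
      (L : ℝ) * frobNorm ((U : Matrix (Fin 2) (Fin 2) ℂ) - (V : Matrix (Fin 2) (Fin 2) ℂ)) := by
  induction L with
  | zero => simp [frobNorm]
  | succ n ih =>
    have hU := su2_mem_unitaryGroup U
    have hVn := su2_mem_unitaryGroup (V ^ n)
    have e : ((U ^ (n + 1) : SU2) : Matrix (Fin 2) (Fin 2) ℂ) - ((V ^ (n + 1) : SU2) : Matrix (Fin 2) (Fin 2) ℂ) =
        (U : Matrix (Fin 2) (Fin 2) ℂ) * (((U ^ n : SU2) : Matrix (Fin 2) (Fin 2) ℂ) - ((V ^ n : SU2) : Matrix (Fin 2) (Fin 2) ℂ)) +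
          ((U : Matrix (Fin 2) (Fin 2) ℂ) - (V : Matrix (Fin 2) (Fin 2) ℂ)) * ((V ^ n : SU2) : Matrix (Fin 2) (Fin 2) ℂ) := by
      have hc : ((V : Matrix (Fin 2) (Fin 2) ℂ)) * ((V ^ n : SU2) : Matrix (Fin 2) (Fin 2) ℂ) =
          ((V ^ n : SU2) : Matrix (Fin 2) (Fin 2) ℂ) * (V : Matrix (Fin 2) (Fin 2) ℂ) := by
        rw [← su2_coe_mul, ← su2_coe_mul, ← pow_succ', ← pow_succ]
      rw [pow_succ', pow_succ', su2_coe_mul, su2_coe_mul, Matrix.mul_sub, sub_mul, hc]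
      abel
    rw [e]
    calc frobNorm ((U : Matrix (Fin 2) (Fin 2) ℂ) * (((U ^ n : SU2) : Matrix (Fin 2) (Fin 2) ℂ) - ((V ^ n : SU2) : Matrix (Fin 2) (Fin 2) ℂ)) +
          ((U : Matrix (Fin 2) (Fin 2) ℂ) - (V : Matrix (Fin 2) (Fin 2) ℂ)) * ((V ^ n : SU2) : Matrix (Fin 2) (Fin 2) ℂ))
        ≤ frobNorm ((U : Matrix (Fin 2) (Fin 2) ℂ) * (((U ^ n : SU2) : Matrix (Fin 2) (Fin 2) ℂ) - ((V ^ n : SU2) : Matrix (Fin 2) (Fin 2) ℂ))) +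
          frobNorm (((U : Matrix (Fin 2) (Fin 2) ℂ) - (V : Matrix (Fin 2) (Fin 2) ℂ)) * ((V ^ n : SU2) : Matrix (Fin 2) (Fin 2) ℂ)) := frobNorm_add_le _ _
      _ = frobNorm (((U ^ n : SU2) : Matrix (Fin 2) (Fin 2) ℂ) - ((V ^ n : SU2) : Matrix (Fin 2) (Fin 2) ℂ)) +
          frobNorm ((U : Matrix (Fin 2) (Fin 2) ℂ) - (V : Matrix (Fin 2) (Fin 2) ℂ)) := by
          rw [frobNorm_unitary_mul hU, frobNorm_mul_unitary _ hVn]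
      _ ≤ (n : ℝ) * frobNorm ((U : Matrix (Fin 2) (Fin 2) ℂ) - (V : Matrix (Fin 2) (Fin 2) ℂ)) +
          frobNorm ((U : Matrix (Fin 2) (Fin 2) ℂ) - (V : Matrix (Fin 2) (Fin 2) ℂ)) := by linarith [ih]
      _ = ((n + 1 : ℕ) : ℝ) * frobNorm ((U : Matrix (Fin 2) (Fin 2) ℂ) - (V : Matrix (Fin 2) (Fin 2) ℂ)) := by push_cast; ring

/-! ## §5 ★ The root chart is Lipschitz on the polar caps, uniformly in `L` -/

/-- The gnomonic coordinate of a configuration, link by link: `linkVec (gnCoord μ U) i = μ⁻¹ • gn(U_i)`. [folklore] -/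
theorem linkVec_gnCoord (μ : ℝ) (U : Cfg) (i : Fin 3) : linkVec (gnCoord μ U) i = μ⁻¹ • (WithLp.toLp 2 (gnLink (U (edgeOf i))) : EuclideanSpace ℝ (Fin 3)) := by
  ext a; simp [linkVec, gnCoord_apply, div_eq_inv_mul]

/-- `μ·‖linkVec (gnCoord μ U) i‖ = gnNorm (U_i)` for `μ > 0`. [folklore] -/
theorem mul_norm_linkVec_gnCoord {μ : ℝ} (hμ : 0 < μ) (U : Cfg) (i : Fin 3) : μ * ‖linkVec (gnCoord μ U) i‖ = gnNorm (U (edgeOf i)) := by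
  rw [linkVec_gnCoord, norm_smul, Real.norm_eq_abs, abs_of_pos (inv_pos.2 hμ), ← mul_assoc, mul_inv_cancel₀ hμ.ne', one_mul, gnNorm,
    EuclideanSpace.norm_eq]
  simp

/-- **The gnomonic chart on a same-sign polar cap**: if every link of `U, V` has `c ≤ scalarPart` (`0 < c ≤ 1`), then
`‖gnCoord μ U − gnCoord μ V‖² ≤ (μ²c⁴)⁻¹·Σ_i ‖U_i − V_i‖_F²` (`μ > 0`). [cite: BrockerTomDieck1985, I (1.10)] -/
theorem norm_gnCoord_sub_sq_le {c : ℝ} (hc : 0 < c) (hc1 : c ≤ 1) {μ : ℝ} (hμ : 0 < μ) {U V : Cfg}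
    (hU : ∀ i, c ≤ scalarPart (U (edgeOf i))) (hV : ∀ i, c ≤ scalarPart (V (edgeOf i))) :
    ‖gnCoord μ U - gnCoord μ V‖ ^ 2 ≤ (μ ^ 2 * c ^ 4)⁻¹ *
      ∑ i, frobNorm (((U (edgeOf i) : SU2) : Matrix (Fin 2) (Fin 2) ℂ) - ((V (edgeOf i) : SU2) : Matrix (Fin 2) (Fin 2) ℂ)) ^ 2 := by
  rw [norm_sq_eq_sum_linkVec, Finset.mul_sum]
  refine Finset.sum_le_sum fun i _ => ?_
  have e : ‖linkVec (gnCoord μ U - gnCoord μ V) i‖ ^ 2 = μ⁻¹ ^ 2 * ∑ a, (gnLink (U (edgeOf i)) a - gnLink (V (edgeOf i)) a) ^ 2 := by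
    rw [linkVec_sub, linkVec_gnCoord, linkVec_gnCoord, ← smul_sub, norm_smul, mul_pow, Real.norm_eq_abs, sq_abs, EuclideanSpace.real_norm_sq_eq]
    rfl
  rw [e]
  have h := sum_gnLink_sub_sq_le hc hc1 (hU i) (hV i)
  calc μ⁻¹ ^ 2 * ∑ a, (gnLink (U (edgeOf i)) a - gnLink (V (edgeOf i)) a) ^ 2
      ≤ μ⁻¹ ^ 2 * (frobNorm (((U (edgeOf i) : SU2) : Matrix (Fin 2) (Fin 2) ℂ) - ((V (edgeOf i) : SU2) : Matrix (Fin 2) (Fin 2) ℂ)) ^ 2 / c ^ 4) :=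
        mul_le_mul_of_nonneg_left h (sq_nonneg _)
    _ = (μ ^ 2 * c ^ 4)⁻¹ * frobNorm (((U (edgeOf i) : SU2) : Matrix (Fin 2) (Fin 2) ℂ) - ((V (edgeOf i) : SU2) : Matrix (Fin 2) (Fin 2) ℂ)) ^ 2 := by
        field_simp

/-- ★★ **The root chart is Lipschitz on the polar cap `u₀ ≥ 3/4`, uniformly in `L ≥ 1`**: if every link of `U` and of `V` has `scalarPart ≥ 3/4`, then
`‖rootCoord L μ U − rootCoord L μ V‖² ≤ (114/μ²)·Σ_i ‖U_i − V_i‖_F²` (`μ > 0`; `6²·(4/3)⁴ = 1024/9 ≤ 114`). [cite: Luscher1983, §2] -/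
theorem norm_rootCoord_sub_sq_le {L : ℕ} (hL : 1 ≤ L) {μ : ℝ} (hμ : 0 < μ) {U V : Cfg}
    (hU : ∀ i, 3 / 4 ≤ scalarPart (U (edgeOf i))) (hV : ∀ i, 3 / 4 ≤ scalarPart (V (edgeOf i))) :
    ‖rootCoord L μ U - rootCoord L μ V‖ ^ 2 ≤ 114 / μ ^ 2 *
      ∑ i, frobNorm (((U (edgeOf i) : SU2) : Matrix (Fin 2) (Fin 2) ℂ) - ((V (edgeOf i) : SU2) : Matrix (Fin 2) (Fin 2) ℂ)) ^ 2 := by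
  have hballU : ∀ i, μ * ‖linkVec (gnCoord μ U) i‖ ≤ 1 := fun i => by
    rw [mul_norm_linkVec_gnCoord hμ]; exact gnNorm_le_one_of_scalarPart ((hU i).trans (le_abs_self _))
  have hballV : ∀ i, μ * ‖linkVec (gnCoord μ V) i‖ ≤ 1 := fun i => by
    rw [mul_norm_linkVec_gnCoord hμ]; exact gnNorm_le_one_of_scalarPart ((hV i).trans (le_abs_self _))
  have h1 := norm_rootRescale_sub_le hL hμ hballU hballV
  have h2 := norm_gnCoord_sub_sq_le (c := 3 / 4) (by norm_num) (by norm_num) hμ hU hV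
  unfold rootCoord
  set S := ∑ i, frobNorm (((U (edgeOf i) : SU2) : Matrix (Fin 2) (Fin 2) ℂ) - ((V (edgeOf i) : SU2) : Matrix (Fin 2) (Fin 2) ℂ)) ^ 2 with hS
  have hS0 : 0 ≤ S := Finset.sum_nonneg fun _ _ => sq_nonneg _
  have h1sq : ‖rootRescale L μ (gnCoord μ U) - rootRescale L μ (gnCoord μ V)‖ ^ 2 ≤ 36 * ‖gnCoord μ U - gnCoord μ V‖ ^ 2 := by
    have := pow_le_pow_left₀ (norm_nonneg _) h1 2
    nlinarith
  have hμ2 : 0 < μ ^ 2 := pow_pos hμ 2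
  have e36 : 36 * ((μ ^ 2 * (3 / 4 : ℝ) ^ 4)⁻¹ * S) = (1024 / 9) / μ ^ 2 * S := by
    field_simp
    ring
  calc ‖rootRescale L μ (gnCoord μ U) - rootRescale L μ (gnCoord μ V)‖ ^ 2 ≤ 36 * ‖gnCoord μ U - gnCoord μ V‖ ^ 2 := h1sq
    _ ≤ 36 * ((μ ^ 2 * (3 / 4 : ℝ) ^ 4)⁻¹ * S) := mul_le_mul_of_nonneg_left h2 (by norm_num)
    _ = (1024 / 9) / μ ^ 2 * S := e36
    _ ≤ 114 / μ ^ 2 * S := mul_le_mul_of_nonneg_right (div_le_div_of_nonneg_right (by norm_num) hμ2.le) hS0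

end Summit.QuantumFields.YangMills.Theorems.FemtoTransferGap.PolyakovLift

end
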